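import Mathlib

/-!
# Federbush, *A phase cell approach to Yang–Mills theory* I (CMP 107 (1986) 319–329) — §0 Estimates 0.1–0.7 (the
# constrained continuum minimiser = «mode»), §1 path averaging (1.10)–(1.11) and the continuum plaquette functional
# (1.12)–(1.14), §2 «Bond Assignments Corresponding to a Given A_μ(x)» ((2.1)–(2.15), uniqueness), §3 «Modes» ((3.1),
# (3.13)–(3.15)), §4 (implications; closing sentence): TYPED STATEMENTS with citation tags

statement-level skeleton of published theorems with citation tags; proofs where landed; nothing here is a claim about the Yang–Mills mass gap

Cell `lit-balaban`, reader/typer block **r17 = Federbush**; SKELETON rows `F1-…` of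
`run/shared/lean/pub/lit-balaban/lit-balaban-r17/SKELETON-r17.md`.  The paper's 'Abelian Stability Theorem' (0.12) with
(1.3)–(1.9) is ALREADY KERNEL-PROVED in the tree (`Federbush1986/AbelianStability.lean`) and is not restated here.

**Source.** P. Federbush, *A phase cell approach to Yang–Mills theory. I. Modes, lattice-continuum duality*, Commun.
Math. Phys. **107** (1986) 319–329 [bib `Federbush1986PhaseCellI`]; journal page = PDF page + 318.  Pages READ AS IMAGES:
p. 320 (Estimates 0.1–0.6, (0.2)–(0.9)), p. 321 (Estimate 0.7 (0.10)–(0.11), (0.12)), p. 323 ((1.5)–(1.11)), p. 324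
((1.12)–(1.14)), p. 325 (§2, (2.1)–(2.6)), p. 326 ((2.7)–(2.15), uniqueness sentence, §3), p. 328 ((3.8)–(3.15), §4), and
the OCR text of p. 327, 329 — Project-Euclid scan `run/shared/lean/pub/pub-balaban/t4/b2b-balaban-t4-lit2/pdf/fed1986-
cmp107.pdf`, renders `…/b2b-balaban-t4-lit2/renders/fed1986/fed1986-cmp107-p002|p003|p005|p008-x2.png` and this seat's
`renders/fedI/fed1986-cmp107-p006|p007|p010-x2.png`.

**Why in the corpus.** Bałaban–Imbrie–Jaffe CMP **97** (1985) ref. [8] and Bałaban CMP **102** (1985) 255 ref. [17] cite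
this paper (as the preprint «I. Small field modes»); the `pub-balaban` T⁴ spine's literature seat lists
`[cite: Federbush1986PhaseCellI, Estimates 0.1–0.7 (0.2)–(0.11) pp. 320–321]` (with the flag «0.1–0.3 = I (3.13)–(3.15),
deduced in Part II») and `I (2.9)/(2.11) p. 326` as citable leaves (`t4/T4-LIT2-CITABLE-NE.md` (L-2), §1.2 (b)–(c)).

**Setting, verbatim (p. 320).** «We consider fixing the group assignments on one of the lattices. We then seek a
continuum field A_μ(x) compatible with this assignment, and minimizing the continuum action subject to this constraint.
[This does not determine A_μ(x) uniquely.] To be specific, let the assignments be fixed on a lattice of length scale L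
(edge size). Assume these assignments are zero (the zero element) for bonds at distance greater than cL from some point
z. We will find an A_μ(x) compatible with this assignment, minimizing the continuum action, and "smooth" enough, so that
the following results hold for the induced assignments to the finer lattices, and for A_μ(x). We let |A(m)| be the
largest assignment, in absolute value, at the length scale L.»  §1 p. 321: lattices `ℒ^r = (2^{−r}ℤ)⁴ ⊂ ℝ⁴`, `ℓ_r = 1/2^r`,
real bond assignments `A(e)` with `A(−e) = −A(e)`, «Averaging (we refer to as Balaban averaging) is defined in Eq. (1.8)
of [1]» ([1] = Bałaban, CMP 95 (1984)).

**How the setting is typed (abstraction note for the referee, F6).**  CONCRETE: `ℝ⁴ = EuclideanSpace ℝ (Fin 4)`; level-r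
edges `Edge r` = (integer base point, direction) with position `2^{−r}·base` (only the positive orientation is a term; the
printed `A(−e) = −A(e)` is the convention for the reverse), plaquettes `Plaq r` = (base, two directions); partial
derivatives `pd A ν μ x = ∂_ν A_μ(x)` («D indicates any first partial»); `d(e, z)`, `d(e₁, e₂)`, `d(p, z)`, `d(p₁, p₂)` are
Euclidean distances between the base vertices («measured between corresponding vertices», p. 320–321 — for `d(e, z)`
print does not say which point of `e`; base vertex is our READING, immaterial up to the constants); `|A(m)|` = `⨆_e |a e|`;
the continuum action `∫ Σ_{μ<ν} (∂_μA_ν − ∂_νA_μ)²` as a `lintegral` (no junk value); the level-`r₀` term of the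
r-approximate bond assignment (2.1)–(2.2) (`approxTop`, tent-weighted cube average) and the continuum plaquette functional
(1.13)–(1.14) in the form print states in words («the average value of ∫ A·ds over translates of a square of edge size
2^{−r} … one corner … varies over the cube … with equal weighting», p. 324: `plaqFunctional`).  ABSTRACT (carried by the
structure `AbelianAveraging`): Bałaban's block averaging (1.8) of [1] between levels, `av s r : (Edge r → ℝ) → (Edge s →
ℝ)` («We establish a maximal tree in each block …», p. 321–322 — the maximal trees are a hidden choice: «they depend on
the particular (arbitrary) choice of maximal tree in each block», p. 325), with its cascade property; from it the
r₀-approximates `A(e, r₀)` («At levels s < r the bond assignments are obtained from the level r assignments by the use of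
Balaban averaging», p. 325) and the bond assignment `A(e) = lim_{r₀→∞} A(e, r₀)` (2.12) are DEFINED here (`bondApprox`,
`bond`; the limit via `limUnder`, its existence being the typed statement `Eq212`).  Every printed claim is then a
predicate on `D : AbelianAveraging`; print asserts them for Bałaban's averaging.  Nothing is weakened; READINGS are
flagged in the docstrings.
-/

namespace Literature.MathematicalPhysics.QuantumFieldTheory.Federbush1986

noncomputable section

open MeasureTheory Filter
open scoped BigOperators Topology

/-! ## Geometry: `ℝ⁴`, the lattices `ℒ^r = (2^{−r}ℤ)⁴`, edges, plaquettes, partial derivatives, the continuum action -/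

/-- `ℝ⁴` with its Euclidean distance («ℒ^r is viewed as (1/2^rℤ)⁴ in R⁴», p. 321). [cite: Federbush1986PhaseCellI, §1
p. 321] -/
abbrev E4 := EuclideanSpace ℝ (Fin 4)

/-- A point of `ℝ⁴` from its four coordinates. [cite: Federbush1986PhaseCellI, §1 p. 321] -/
def mkPt (f : Fin 4 → ℝ) : E4 := WithLp.toLp 2 f

/-- The unit vector in direction `i`. [cite: Federbush1986PhaseCellI, §1 p. 321] -/
def unitVec (i : Fin 4) : E4 := EuclideanSpace.single i (1 : ℝ)

/-- «the edge size of ℒ^r, ℓ_r = 1/2^r» (p. 321). [cite: Federbush1986PhaseCellI, §1 p. 321] -/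
def latLen (r : ℕ) : ℝ := ((2 : ℝ) ^ r)⁻¹

/-- A (positively oriented) edge of `ℒ^r = (2^{−r}ℤ)⁴`: base vertex `2^{−r}·base`, direction `dir`, joining the base to
`base + 2^{−r}e_dir` (p. 325: «a bond (edge) at level r, joining (x_i, x_j, x_t, x_s) and (x_i + 2^{−r}, x_j, x_t, x_s)»).
[cite: Federbush1986PhaseCellI, §1 p. 321, §2 p. 325] -/
structure Edge (r : ℕ) where
  /-- integer coordinates of the base vertex (in units of `ℓ_r`) -/
  base : Fin 4 → ℤ
  /-- direction -/
  dir : Fin 4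

/-- The base vertex of an edge as a point of `ℝ⁴`. [cite: Federbush1986PhaseCellI, §1 p. 321] -/
def Edge.src {r : ℕ} (e : Edge r) : E4 := mkPt fun k => latLen r * (e.base k : ℝ)

/-- A plaquette of `ℒ^r` «parallel to the i–j direction» with lower-left vertex `base` (Fig. 4 p. 324).
[cite: Federbush1986PhaseCellI, (1.12)–(1.13) and Fig. 4 p. 324] -/
structure Plaq (r : ℕ) where
  /-- integer coordinates of the lower-left vertex -/
  base : Fin 4 → ℤ
  /-- first direction `i` -/
  dir₁ : Fin 4
  /-- second direction `j` -/
  dir₂ : Fin 4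

/-- The base vertex of a plaquette. [cite: Federbush1986PhaseCellI, Fig. 4 p. 324] -/
def Plaq.src {r : ℕ} (p : Plaq r) : E4 := mkPt fun k => latLen r * (p.base k : ℝ)

/-- The boundary value `A_{∂p} = A(e₁) + A(e₂) − A(e₃) − A(e₄)` of a bond assignment around the plaquette `p` (edges:
base→base+e_i, base+e_i→base+e_i+e_j, reversed base+e_j→base+e_i+e_j, reversed base→base+e_j), abelian group «the
additive group of real numbers» (p. 319). [cite: Federbush1986PhaseCellI, §0 p. 319–320, (1.4) p. 322] -/
def plaqOfBonds {r : ℕ} (a : Edge r → ℝ) (p : Plaq r) : ℝ :=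
  a ⟨p.base, p.dir₁⟩ + a ⟨p.base + Pi.single p.dir₁ 1, p.dir₂⟩
    - a ⟨p.base + Pi.single p.dir₂ 1, p.dir₁⟩ - a ⟨p.base, p.dir₂⟩

/-- `∂_ν A_μ(x)` — «D indicates any first partial» (p. 320). [cite: Federbush1986PhaseCellI, Estimate 0.2 (0.3) p. 320] -/
def pd (A : E4 → Fin 4 → ℝ) (ν μ : Fin 4) (x : E4) : ℝ := fderiv ℝ (fun y => A y μ) x (unitVec ν)

/-- The (abelian, non-compact) continuum action `∫ Σ_{μ<ν} (∂_μA_ν − ∂_νA_μ)² d⁴x` as an extended non-negative number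
(no junk value for non-integrable competitors).  READING: print never displays the continuum action in I («minimizing the
continuum action», p. 320); this is the standard abelian Yang–Mills action up to a constant factor, immaterial for
«minimizing». [cite: Federbush1986PhaseCellI, §0 p. 319–320] -/
def contAction (A : E4 → Fin 4 → ℝ) : ENNReal :=
  ∫⁻ x, ENNReal.ofReal (∑ μ : Fin 4, ∑ ν : Fin 4, if μ < ν then (pd A μ ν x - pd A ν μ x) ^ 2 else 0)

/-! ## §1 — the continuum plaquette functional (1.12)–(1.14) and §2 — the level-`r` term (2.1)–(2.2) -/

/-- `∫_0^ℓ A_i(x + t e_i) dt` — the line integral of `A` along the segment from `x` of length `ℓ` in direction `i`.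
[cite: Federbush1986PhaseCellI, (1.13) and the sentence after (1.14) p. 324] -/
def lineInt (A : E4 → Fin 4 → ℝ) (x : E4) (i : Fin 4) (ℓ : ℝ) : ℝ := ∫ t in (0 : ℝ)..ℓ, A (x + t • unitVec i) i

/-- `∮_{∂□} A·ds` around the square with corner `x`, sides `ℓ e_i`, `ℓ e_j` (counter-clockwise `i` then `j`).
[cite: Federbush1986PhaseCellI, (1.13) and the sentence after (1.14) p. 324] -/
def loopInt (A : E4 → Fin 4 → ℝ) (x : E4) (i j : Fin 4) (ℓ : ℝ) : ℝ :=
  lineInt A x i ℓ + lineInt A (x + ℓ • unitVec i) j ℓ - lineInt A (x + ℓ • unitVec j) i ℓ - lineInt A x j ℓ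

/-- **(1.13)–(1.14)**, the continuum plaquette assignment `A_{∂p} = ∫ d⁴x χ_p(x)·A(x) = (χ_p, A)` in the form print gives
in words: «The right side of (1.13) is the average value of ∫ A·ds over translates of a square of edge size 2^{−r} and
parallel to the i–j coordinate axes. The position of one corner of the square varies over the cube x_k ≤ x̄_k ≤ x_k + 2^{−r}
with equal weighting during averaging.» (the displayed (1.12)–(1.13) is this average written out with the tent functions
`A(x, y), B(x, y)` on `[0, 2]²`).  Here: the unit-cube average over `u ∈ [0,1]⁴` of the loop integral around the square
with corner `p.src + 2^{−r}u`. [cite: Federbush1986PhaseCellI, (1.12)–(1.14) p. 324] -/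
def plaqFunctional (r : ℕ) (A : E4 → Fin 4 → ℝ) (p : Plaq r) : ℝ :=
  ∫ u in Set.Icc (0 : Fin 4 → ℝ) 1, loopInt A (p.src + latLen r • mkPt u) p.dir₁ p.dir₂ (latLen r)

/-- The tent weight of (2.2) in units of `ℓ_r`: «c(x) = 2^r(x − x_i) for (x − x_i) ≤ 2^{−r}, 2 − 2^r(x − x_i) for
(x − x_i) ≥ 2^{−r}». [cite: Federbush1986PhaseCellI, (2.2) p. 325] -/
def tent (v : ℝ) : ℝ := if v ≤ 1 then v else 2 - v

/-- **(2.1)–(2.2)**, the level-`r` bond assignment of the r-approximate procedure: «We associate to this bond (with an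
orientation in the + x_i direction) the group element 2^{3r} ∫_{x_t}^{x_t+2^{−r}} dx_t ∫_{x_s}^{x_s+2^{−r}} dx_s
∫_{x_i}^{x_i+2·2^{−r}} dx ∫_{x_j}^{x_j+2^{−r}} dy c(x)A_i(·), (2.1)» — after the substitution `x = e.src + ℓ_r u` this is
`ℓ_r ∫ tent(u_i) A_i(e.src + ℓ_r u) du` over `u ∈ [0,1]³ × [0,2]` (longitudinal coordinate `i = e.dir` over `[0, 2]`).
[cite: Federbush1986PhaseCellI, (2.1)–(2.2) p. 325] -/
def approxTop (r : ℕ) (A : E4 → Fin 4 → ℝ) (e : Edge r) : ℝ :=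
  latLen r * ∫ u in Set.Icc (0 : Fin 4 → ℝ) (fun k => if k = e.dir then 2 else 1),
    tent (u e.dir) * A (e.src + latLen r • mkPt u) e.dir

/-! ## The carrier: Bałaban averaging between levels (abstract), the r-approximates and the bond assignment (2.12) -/

/-- The ABSTRACT part of the setting (F6): Bałaban's block averaging of real bond assignments from level `r` to a coarser
level `s ≤ r` («Averaging (we refer to as Balaban averaging) is defined in Eq. (1.8) of [1]. We establish a maximal tree in
each block …», p. 321–322; iterated/cascaded as in (1.11) «By iterating we obtain a similar formula for A_Γ as an average
over paths in ℒ^s, s > r»), with the cascade (compatibility) property and `av r r = id`.  The maximal trees are a hidden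
choice.  Print's statements below are predicates on this structure, asserted for Bałaban's averaging.
[cite: Federbush1986PhaseCellI, §1 (1.10)–(1.11) p. 321–324; §2 p. 325] -/
structure AbelianAveraging where
  /-- `av s r a` = the level-`s` assignment obtained by averaging the level-`r` assignment `a` (`s ≤ r`) -/
  av : (s r : ℕ) → (Edge r → ℝ) → (Edge s → ℝ)
  /-- no averaging at equal levels -/
  av_self : ∀ r (a : Edge r → ℝ), av r r a = a
  /-- cascade: averaging `r → q → s` equals averaging `r → s` (`s ≤ q ≤ r`) — compatibility of the family -/
  av_trans : ∀ s q r, s ≤ q → q ≤ r → ∀ (a : Edge r → ℝ), av s q (av q r a) = av s r a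

namespace AbelianAveraging

variable (D : AbelianAveraging)

/-- A COMPATIBLE family of assignments («the assignments to any one of the lattices are determined in terms of the
assignments to any finer lattice, by an averaging procedure due to Balaban», p. 319). [cite: Federbush1986PhaseCellI, §0
p. 319, §1 p. 321] -/
def Compatible (a : (r : ℕ) → Edge r → ℝ) : Prop := ∀ s r, s ≤ r → D.av s r (a r) = a s

/-- The r₀-approximate assignment `A(e, r₀)` to an edge `e` at level `s ≤ r₀`: (2.1)–(2.2) at level `r₀`, then «At levels
s < r the bond assignments are obtained from the level r assignments by the use of Balaban averaging.» (p. 325).  (For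
`s > r₀` the value is the junk `av`-value; never used.) [cite: Federbush1986PhaseCellI, §2 'r-Approximate Bond Assignments'
p. 325] -/
def bondApprox (r₀ s : ℕ) (A : E4 → Fin 4 → ℝ) : Edge s → ℝ := D.av s r₀ (approxTop r₀ A)

/-- **(2.12)** as a DEFINITION: «A(e) = lim_{r₀→∞} A(e, r₀). (2.12)» — the bond assignment corresponding to `A_μ(x)`
(`limUnder`; that the limit exists is the typed statement `Eq212`). [cite: Federbush1986PhaseCellI, (2.12) p. 326] -/
def bond (s : ℕ) (A : E4 → Fin 4 → ℝ) (e : Edge s) : ℝ := limUnder atTop fun r₀ => D.bondApprox r₀ s A e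

/-- The plaquette assignment at level `s` induced by `A_μ` through its bond assignments. [cite: Federbush1986PhaseCellI,
§1–§2 pp. 322–325] -/
def plaq (s : ℕ) (A : E4 → Fin 4 → ℝ) (p : Plaq s) : ℝ := plaqOfBonds (D.bond s A) p

/-! ## §0 — Estimates 0.1–0.7 and the existence statement of the constrained minimiser («mode») -/

/-- «|A(m)| … the largest assignment, in absolute value, at the length scale L» (p. 320). [cite: Federbush1986PhaseCellI,
§0 p. 320] -/
def maxAssign {r₀ : ℕ} (a : Edge r₀ → ℝ) : ℝ := ⨆ e, |a e|

/-- «A_μ(x) compatible with this assignment, and minimizing the continuum action subject to this constraint» (p. 320):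
`A` is `C¹`, its level-`r₀` bond assignments are the given `a`, and no `C¹` competitor with the same level-`r₀`
assignments has smaller action. [cite: Federbush1986PhaseCellI, §0 p. 320; §3 p. 327] -/
def IsConstrainedMinimizer (r₀ : ℕ) (a : Edge r₀ → ℝ) (A : E4 → Fin 4 → ℝ) : Prop :=
  ContDiff ℝ 1 A ∧ D.bond r₀ A = a ∧
    ∀ A' : E4 → Fin 4 → ℝ, ContDiff ℝ 1 A' → D.bond r₀ A' = a → contAction A ≤ contAction A'

/-- **Estimate 0.1.** «|A_μ(x)| < c (1/L) e^{−γ|x−z|/L} |A(m)|. (0.2)»  ERRATUM (v1.2): strict «<» as printed is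
unsatisfiable at `|A(m)| = 0` (`not_estimate01_zero`, p252610); the `≤` reading of record is `Estimate01Le`
(`AbelianEstimatesLe.lean`, knitting `Estimate01.le`). [cite: Federbush1986PhaseCellI, Estimate 0.1 (0.2) p. 320] -/
def Estimate01 (c γ L : ℝ) (z : E4) (Am : ℝ) (A : E4 → Fin 4 → ℝ) : Prop :=
  ∀ x μ, |A x μ| < c * (1 / L) * Real.exp (-γ * dist x z / L) * Am

/-- **Estimate 0.2.** «|DA_μ(x)| < (c/L²) e^{−γ|x−z|/L} |A(m)|, (0.3) where D indicates any first partial.»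
v1.2: `≤` reading `Estimate02Le` (p252610, knitting `Estimate02.le`). [cite: Federbush1986PhaseCellI, Estimate 0.2 (0.3) p. 320] -/
def Estimate02 (c γ L : ℝ) (z : E4) (Am : ℝ) (A : E4 → Fin 4 → ℝ) : Prop :=
  ∀ x ν μ, |pd A ν μ x| < c / L ^ 2 * Real.exp (-γ * dist x z / L) * Am

/-- **Estimate 0.3.** «(1/|x−y|^{1−ε}) |DA_μ(x) − DA_μ(y)| < (c_ε/L^{3−ε}) e^{−γ|x−z|/L} |A(m)| each ε > 0, (0.4) where
|x − y| < cL. (0.5)» (`x ≠ y` implicit).  v1.2: `≤` reading `Estimate03Le` (p252610). [cite: Federbush1986PhaseCellI,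
Estimate 0.3 (0.4)–(0.5) p. 320] -/
def Estimate03 (c γ L : ℝ) (cε : ℝ → ℝ) (z : E4) (Am : ℝ) (A : E4 → Fin 4 → ℝ) : Prop :=
  ∀ ε > (0 : ℝ), ∀ x y ν μ, x ≠ y → dist x y < c * L →
    |pd A ν μ x - pd A ν μ y| / dist x y ^ (1 - ε) < cε ε / L ^ (3 - ε) * Real.exp (-γ * dist x z / L) * Am

/-- **Estimate 0.4.** «Let e be an edge at length scale l, and A(e) the corresponding assigned group element
|A(e)| < c (l/L) e^{−γd(e,z)/L} |A(m)|. (0.6)» — for the induced assignments at the finer levels `s ≥ r₀` (`l = ℓ_s ≤ L`).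
v1.2: `≤` reading `Estimate04Le` (p252610). [cite: Federbush1986PhaseCellI, Estimate 0.4 (0.6) p. 320] -/
def Estimate04 (r₀ : ℕ) (c γ L : ℝ) (z : E4) (Am : ℝ) (A : E4 → Fin 4 → ℝ) : Prop :=
  ∀ s, r₀ ≤ s → ∀ e : Edge s, |D.bond s A e| < c * (latLen s / L) * Real.exp (-γ * dist e.src z / L) * Am

/-- **Estimate 0.5.** «Let e₁ and e₂ be parallel (oriented) edges at length scale l, |A(e₁) − A(e₂)| < c (l/L)·(d(e₁,e₂)/L)
e^{−γd(e₁,z)/L} |A(m)|, (0.7) where d(e₁, e₂) < cL. (0.8) [We understand here parallel edges to have same orientation, and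
d(e₁, e₂) is measured between corresponding vertices.]»  ERRATUM (v1.2): strict «<» as printed is unsatisfiable at
`e₁ = e₂` (`not_estimate05_self`, p252610); `≤` reading of record `Estimate05Le` (region constant (0.8) separated from the
bound constant (0.7)). [cite: Federbush1986PhaseCellI, Estimate 0.5 (0.7)–(0.8) p. 320] -/
def Estimate05 (r₀ : ℕ) (c γ L : ℝ) (z : E4) (Am : ℝ) (A : E4 → Fin 4 → ℝ) : Prop :=
  ∀ s, r₀ ≤ s → ∀ e₁ e₂ : Edge s, e₁.dir = e₂.dir → dist e₁.src e₂.src < c * L →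
    |D.bond s A e₁ - D.bond s A e₂|
      < c * (latLen s / L) * (dist e₁.src e₂.src / L) * Real.exp (-γ * dist e₁.src z / L) * Am

/-- **Estimate 0.6.** «Let p be a plaquette at length scale l, and A_{∂p} the corresponding group assignment,
|A_{∂p}| < c (l/L)² e^{−γd(p,z)/L} |A(m)|. (0.9)»  v1.2: `≤` reading `Estimate06Le` (p252610). [cite: Federbush1986PhaseCellI,
Estimate 0.6 (0.9) p. 320] -/
def Estimate06 (r₀ : ℕ) (c γ L : ℝ) (z : E4) (Am : ℝ) (A : E4 → Fin 4 → ℝ) : Prop :=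
  ∀ s, r₀ ≤ s → ∀ p : Plaq s, |D.plaq s A p| < c * (latLen s / L) ^ 2 * Real.exp (-γ * dist p.src z / L) * Am

/-- **Estimate 0.7.** «Let p₁ and p₂ be parallel (oriented) plaquettes at length scale l, |A_{∂p₁} − A_{∂p₂}| <
c_ε (d(p₁,p₂))^{1−ε} (l²/L^{3−ε}) e^{−γd(p₁,z)/L} |A(m)| each ε > 0, (0.10) where d(p₁, p₂) is measured between corresponding
vertices and d(p₁, p₂) < cL. (0.11)»  ERRATUM (v1.2): strict «<» as printed is unsatisfiable at `p₁ = p₂`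
(`not_estimate07_self`, p252610); `≤` reading of record `Estimate07Le`. [cite: Federbush1986PhaseCellI, Estimate 0.7
(0.10)–(0.11) p. 321] -/
def Estimate07 (r₀ : ℕ) (c γ L : ℝ) (cε : ℝ → ℝ) (z : E4) (Am : ℝ) (A : E4 → Fin 4 → ℝ) : Prop :=
  ∀ ε > (0 : ℝ), ∀ s, r₀ ≤ s → ∀ p₁ p₂ : Plaq s, p₁.dir₁ = p₂.dir₁ → p₁.dir₂ = p₂.dir₂ →
    dist p₁.src p₂.src < c * L →
      |D.plaq s A p₁ - D.plaq s A p₂|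
        < cε ε * dist p₁.src p₂.src ^ (1 - ε) * (latLen s ^ 2 / L ^ (3 - ε))
            * Real.exp (-γ * dist p₁.src z / L) * Am

/-- **The statement of §0** (p. 320): for bond assignments `a` fixed on the lattice of edge size `L = ℓ_{r₀}`, vanishing
«for bonds at distance greater than cL from some point z», «We will find an A_μ(x) compatible with this assignment,
minimizing the continuum action, and "smooth" enough, so that the following results hold for the induced assignments to
the finer lattices, and for A_μ(x)»: Estimates 0.1–0.7 with constants `c`, `γ`, `c_ε` uniform in `r₀`, `z`, `a` (print's
generic-constant convention; «By scaling arguments it is enough to study level 0 modes … By translation invariance and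
linearity we may restrict our study to the single configuration … having exactly one non-zero value», p. 327 — so the
constants may depend on the support-radius constant `c₀`, which is quantified first).  Proof: §3–§4 from (3.13)–(3.15),
which are «postpone[d] to Part II» (Federbush–Williamson, JMP 28 (1987) 1416).
ERRATUM (v1.2, fold owner r17 gen 4, 2026-08-21; SKELETON row F1.Eq3.1 `refuted-as-typed p252610`).  AS TYPED this
predicate is FALSE for every carrier `D`: `AbelianAveraging.not_modeEstimates` (`AbelianEstimatesLe.lean`, seat p04 gen 6,
p252610) — the zero data `a = 0` is admissible («vanishing outside the ball» holds trivially), `maxAssign 0 = 0`, and the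
printed STRICT inequality (0.2) then demands `|A_μ(x)| < 0`; independently (0.7) at `e₁ = e₂` and (0.10) at `p₁ = p₂`
demand `0 < 0` (`not_estimate05_self`, `not_estimate07_self`).  Nothing in print fails: the generic-constant strict «<» of
§0 is vacuous exactly at degenerate data, and the typing copied it verbatim (this file already reads (2.13)/(2.15) with
`≤` for the same reason).  STATEMENT OF RECORD: `AbelianAveraging.ModeEstimatesLe` (p252610; same signature with `<` ↦ `≤`
in Estimates 0.1–0.7, i.e. `Estimate01Le … Estimate07Le`; knitting `ModeEstimates.le`).  This v1 predicate is kept with its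
body unchanged (never edited in place); consumers should take `(h : D.ModeEstimatesLe)`.
[cite: Federbush1986PhaseCellI, §0 pp. 320–321 (Estimates 0.1–0.7); §3 p. 327; §4 pp. 328–329] -/
def ModeEstimates : Prop :=
  ∀ c₀ > (0 : ℝ), ∃ c > (0 : ℝ), ∃ γ > (0 : ℝ), ∃ cε : ℝ → ℝ,
    ∀ (r₀ : ℕ) (z : E4) (a : Edge r₀ → ℝ),
      (∀ e : Edge r₀, c₀ * latLen r₀ < dist e.src z → a e = 0) →
        ∃ A : E4 → Fin 4 → ℝ, D.IsConstrainedMinimizer r₀ a A ∧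
          Estimate01 c γ (latLen r₀) z (maxAssign a) A ∧ Estimate02 c γ (latLen r₀) z (maxAssign a) A ∧
          Estimate03 c γ (latLen r₀) cε z (maxAssign a) A ∧ D.Estimate04 r₀ c γ (latLen r₀) z (maxAssign a) A ∧
          D.Estimate05 r₀ c γ (latLen r₀) z (maxAssign a) A ∧ D.Estimate06 r₀ c γ (latLen r₀) z (maxAssign a) A ∧
          D.Estimate07 r₀ c γ (latLen r₀) cε z (maxAssign a) A

/-! ## §2 — the r-approximates: (2.5)–(2.7), (2.9)–(2.11), the limit (2.12), (2.13)–(2.15), uniqueness -/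

/-- **(2.5)–(2.6)** under (2.3) «|A_μ(x)| ≤ B₁»: «If e is at level r₀, we easily see from (2.1), (2.2), and (2.3) that
|A(e, r₀)| ≤ B₁ℓ_{r₀}. (2.5) Using the bound on the number of edges of averaged paths … (2.5) implies |A(e, r₀)| ≤ cB₁ℓ(e),
(2.6) where ℓ(e) = ℓ_s if e is at (length) scale s» — `c` independent of `r₀` («Note that the bounds in (2.6) and (2.7) are
independent of r₀»). [cite: Federbush1986PhaseCellI, (2.3), (2.5)–(2.6) p. 325–326] -/
def Eq206 : Prop :=
  ∃ c : ℝ, ∀ (A : E4 → Fin 4 → ℝ) (B₁ : ℝ), ContDiff ℝ 1 A → (∀ x μ, |A x μ| ≤ B₁) →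
    ∀ r₀ s, s ≤ r₀ → ∀ e : Edge s, |D.bondApprox r₀ s A e| ≤ c * B₁ * latLen s

/-- **(2.7)** under (2.4) «|DA_μ(x)| ≤ B₂»: «Similarly if e₁ is parallel to e₂ and at the same scale |A(e₁, r₀) − A(e₂, r₀)|
≤ cd(e₁, e₂)B₂ℓ(e₁). (2.7)» [cite: Federbush1986PhaseCellI, (2.4), (2.7) p. 325–326] -/
def Eq207 : Prop :=
  ∃ c : ℝ, ∀ (A : E4 → Fin 4 → ℝ) (B₂ : ℝ), ContDiff ℝ 1 A → (∀ x ν μ, |pd A ν μ x| ≤ B₂) →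
    ∀ r₀ s, s ≤ r₀ → ∀ e₁ e₂ : Edge s, e₁.dir = e₂.dir →
      |D.bondApprox r₀ s A e₁ - D.bondApprox r₀ s A e₂| ≤ c * dist e₁.src e₂.src * B₂ * latLen s

/-- **(2.8)–(2.9)**: «if the assignments to edges at scale r₀ are changed with a bound ε |δA(e)| < ε, (2.8) we find that
the corresponding assignments at higher scales, as determined by averaging, are changed with bound |δA(e)| <
c(ℓ(e)/ℓ_{r₀})ε, (2.9) again by consideration of path averaging and a bound on the edges in Γ̂_α.» — a sup-norm Lipschitz
bound for the averaging `ℒ^{r₀} → ℒ^s` with constant `c·2^{r₀−s}` (the T⁴ spine's NE2 pointer, `T4-LIT2-CITABLE-NE` §1.2 (c)).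
[cite: Federbush1986PhaseCellI, (2.8)–(2.9) p. 326] -/
def Eq209 : Prop :=
  ∃ c : ℝ, ∀ (r₀ s : ℕ), s ≤ r₀ → ∀ (ε : ℝ) (a a' : Edge r₀ → ℝ), (∀ e, |a e - a' e| < ε) →
    ∀ e : Edge s, |D.av s r₀ a e - D.av s r₀ a' e| < c * (latLen s / latLen r₀) * ε

/-- **(2.10)–(2.11)** under (2.4): «Now let e be an edge at level r₀. We view the difference A(e, r₀) − A(e, r₀ + 1), and
find |A(e, r₀) − A(e, r₀ + 1)| < cB₂ℓ²_{r₀}. (2.10) … Using (2.9) and (2.10) we get for any edge at level s < r₀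
|A(e, r₀) − A(e, r₀ + 1)| ≤ c·(ℓ(e)/ℓ_{r₀})·B₂ℓ²_{r₀}. (2.11)» (typed for `s ≤ r₀`, which includes (2.10)).
[cite: Federbush1986PhaseCellI, (2.10)–(2.11) p. 326] -/
def Eq211 : Prop :=
  ∃ c : ℝ, ∀ (A : E4 → Fin 4 → ℝ) (B₂ : ℝ), ContDiff ℝ 1 A → (∀ x ν μ, |pd A ν μ x| ≤ B₂) →
    ∀ r₀ s, s ≤ r₀ → ∀ e : Edge s,
      |D.bondApprox r₀ s A e - D.bondApprox (r₀ + 1) s A e| ≤ c * (latLen s / latLen r₀) * B₂ * latLen r₀ ^ 2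

/-- **(2.12)** «This proves that the limit of r-approximates exists and we get the edge assignments corresponding to
A_μ(x), A(e) = lim_{r₀→∞} A(e, r₀). (2.12)» — for `C¹` fields with the bounds (2.3)–(2.4). [cite: Federbush1986PhaseCellI,
(2.12) p. 326] -/
def Eq212 : Prop :=
  ∀ (A : E4 → Fin 4 → ℝ) (B₁ B₂ : ℝ), ContDiff ℝ 1 A → (∀ x μ, |A x μ| ≤ B₁) → (∀ x ν μ, |pd A ν μ x| ≤ B₂) →
    ∀ s (e : Edge s), Tendsto (fun r₀ => D.bondApprox r₀ s A e) atTop (𝓝 (D.bond s A e))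

/-- **(2.13)** «The limit assignments satisfy (2.6) and (2.7) and in fact we may write |A(e)| < cℓ(e) Sup_{d(x,e)<cℓ(e)}
|A_μ(x)|, (2.13)» («A(e) depends only on A_μ(x) for d(x, e) < cℓ(e)»).  Typed with `≤` against the supremum over the open
ball about the base vertex (strictness as printed fails for `A ≡ 0`; READING). [cite: Federbush1986PhaseCellI, (2.13) p. 326] -/
def Eq213 : Prop :=
  ∃ c : ℝ, ∀ (A : E4 → Fin 4 → ℝ) (B₁ B₂ : ℝ), ContDiff ℝ 1 A → (∀ x μ, |A x μ| ≤ B₁) → (∀ x ν μ, |pd A ν μ x| ≤ B₂) →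
    ∀ s (e : Edge s), |D.bond s A e| ≤ c * latLen s * ⨆ x : Metric.ball e.src (c * latLen s), ⨆ μ, |A x μ|

/-- **(2.14)–(2.15)** «and for e₁ ∥ e₂ at the same level, and satisfying d(e₁, e₂) < cL, L > ℓ(e₁), (2.14)
|A(e₁) − A(e₂)| < cd(e₁, e₂)ℓ(e₁) Sup_{d(x,e)<cL} |DA_μ(x)|. (2.15)» (READING: `≤`, as for (2.13)).
[cite: Federbush1986PhaseCellI, (2.14)–(2.15) p. 326] -/
def Eq215 : Prop :=
  ∃ c : ℝ, ∀ (A : E4 → Fin 4 → ℝ) (B₁ B₂ : ℝ), ContDiff ℝ 1 A → (∀ x μ, |A x μ| ≤ B₁) → (∀ x ν μ, |pd A ν μ x| ≤ B₂) →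
    ∀ s (e₁ e₂ : Edge s) (L : ℝ), e₁.dir = e₂.dir → dist e₁.src e₂.src < c * L → latLen s < L →
      |D.bond s A e₁ - D.bond s A e₂|
        ≤ c * dist e₁.src e₂.src * latLen s * ⨆ x : Metric.ball e₁.src (c * L), ⨆ ν, ⨆ μ, |pd A ν μ x|

/-- **Uniqueness** «It is immediate that a given compatible set of assignments to the lattices arises from (is associated
to) at most one continuously differentiable A_μ(x).» (p. 326) — injectivity of `A ↦ (A(e))_e` on `C¹` fields with the
bounds (2.3)–(2.4). [cite: Federbush1986PhaseCellI, §2 last sentence p. 326] -/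
def BondAssignmentInjective : Prop :=
  ∀ (A A' : E4 → Fin 4 → ℝ) (B₁ B₂ : ℝ), ContDiff ℝ 1 A → ContDiff ℝ 1 A' →
    (∀ x μ, |A x μ| ≤ B₁) → (∀ x ν μ, |pd A ν μ x| ≤ B₂) → (∀ x μ, |A' x μ| ≤ B₁) → (∀ x ν μ, |pd A' ν μ x| ≤ B₂) →
      (∀ s (e : Edge s), D.bond s A e = D.bond s A' e) → A = A'

/-- **(1.13) is consistent / (2.1) «yields the correct plaquette variables»**: «The assignments via Eq. (1.13) automatically
satisfy the consistency requirements, of Balaban averaging.» (p. 324) and «It is easy to ferret out that this assignment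
yields the correct plaquette variables.» (p. 325): the plaquette values of the induced bond assignments are the
functional (1.13)–(1.14) at every level. [cite: Federbush1986PhaseCellI, (1.13)–(1.14) p. 324; §2 p. 325] -/
def PlaquetteAssignmentsEq114 : Prop :=
  ∀ (A : E4 → Fin 4 → ℝ) (B₁ B₂ : ℝ), ContDiff ℝ 1 A → (∀ x μ, |A x μ| ≤ B₁) → (∀ x ν μ, |pd A ν μ x| ≤ B₂) →
    ∀ s (p : Plaq s), D.plaq s A p = plaqFunctional s A p

/-! ## §3 — modes; the Part-II input (3.13)–(3.15); §4 the closing sentence -/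

/-- «a level r mode is a compatible assignment of bond averages, to the ℒ^r, arising from an A_μ(x) (continuously
differentiable) such that for some point z, and for level r edges e_i, A(e_i) = 0 if d(e_i, z) > cℓ_r. (3.1) We also
require A_μ(x) to minimize the continuum action, subject to the constraint of having the bond assignments at level r
fixed.» [cite: Federbush1986PhaseCellI, §3 (3.1) p. 326–327] -/
def IsMode (c : ℝ) (r : ℕ) (A : E4 → Fin 4 → ℝ) : Prop :=
  ∃ z : E4, (∀ e : Edge r, c * latLen r < dist e.src z → D.bond r A e = 0) ∧
    D.IsConstrainedMinimizer r (D.bond r A) A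

/-- **(3.13)–(3.15)** (proved in Part II: «We there show»): the Landau-gauge potential `A^N_μ` of the level-0 mode with a
single non-zero bond assignment (unity, the bond in the +1 direction at the origin, II p. 1416) satisfies
«|A^N_μ(x)| < ce^{−γ|x|}, (3.13) |DA^N_μ(x)| < ce^{−γ|x|}, (3.14) (1/|x−y|^{1−ε}) |DA^N_μ(x) − DA^N_μ(y)| < c_εe^{−γ|x|}, (3.15) for
each ε > 0, |x − y| < 1.»  TYPED as the decay/regularity package of a field `AN` (the identification of `AN` with the
Fourier-transform formula (3.12)/II (2.4) is Part II's object, see `Federbush1986/ModeAnalyticity`).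
[cite: Federbush1986PhaseCellI, (3.13)–(3.15) p. 328; FederbushWilliamson1987PhaseCellII, §IV p. 1417] -/
def Decay313to315 (AN : E4 → Fin 4 → ℝ) : Prop :=
  ∃ c > (0 : ℝ), ∃ γ > (0 : ℝ), ∃ cε : ℝ → ℝ, ContDiff ℝ 1 AN ∧
    (∀ x μ, |AN x μ| < c * Real.exp (-γ * ‖x‖)) ∧ (∀ x ν μ, |pd AN ν μ x| < c * Real.exp (-γ * ‖x‖)) ∧
    (∀ ε > (0 : ℝ), ∀ x y ν μ, x ≠ y → dist x y < 1 →
      |pd AN ν μ x - pd AN ν μ y| / dist x y ^ (1 - ε) < cε ε * Real.exp (-γ * ‖x‖))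

/-- The level-`r` lattice Wilson action of a compatible abelian family, `S^r_0 = Σ_p (A_{∂p})²` over the (unoriented,
`i < j`) plaquettes of `ℒ^r` (d = 4: no prefactor).  READING: I prints no display for `S^r_0` (cf. VI (10) `¼Σ|g_{∂p}|²`);
normalisation immaterial for (0.12) and fixed here consistently with `contAction`. [cite: Federbush1986PhaseCellI, (0.12)
p. 321; §4 last sentence p. 329] -/
def latticeAction (r : ℕ) (a : Edge r → ℝ) : ℝ :=
  ∑' p : Plaq r, if p.dir₁ < p.dir₂ then plaqOfBonds a p ^ 2 else 0

/-- **§4, closing sentence**: «As a final note we point out it is straightforward to show the lattice actions S^r_0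
approach the continuum action as r → ∞.» — for the modes of the paper (the non-abelian version is VI Theorem 2).
[cite: Federbush1986PhaseCellI, §4 p. 329] -/
def LatticeActionsConverge (c : ℝ) : Prop :=
  ∀ (r : ℕ) (A : E4 → Fin 4 → ℝ), D.IsMode c r A →
    Tendsto (fun s => ENNReal.ofReal (latticeAction s (D.bond s A))) atTop (𝓝 (contAction A))

/-! ### v1.1 (append-only; NOTE-j of referee ref-3, gen 5): junk-free lattice-action convergence
`latticeAction` is a `tsum` over the infinite plaquette set `Plaq r`, hence the junk value `0` when the family is not
summable; a consumer of `LatticeActionsConverge` would then read a statement about junk.  The predicate below carries the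
summability of every level's plaquette sum as an explicit conjunct (print: «the lattice actions S^r_0 approach the continuum
action», which presupposes that each `S^r_0` is a number); it implies the v1 predicate.  `contAction` is a `lintegral`
(`ℝ≥0∞`, no junk). -/

/-- The summand of `latticeAction`: `(A_{∂p})²` on the unoriented (`dir₁ < dir₂`) plaquettes, `0` on the others.
[cite: Federbush1986PhaseCellI, (0.12) p. 321; §4 p. 329] -/
def plaqTerm (r : ℕ) (a : Edge r → ℝ) (p : Plaq r) : ℝ :=
  if p.dir₁ < p.dir₂ then plaqOfBonds a p ^ 2 else 0

/-- `S^r_0 = Σ_p plaqTerm` (unfolding). [cite: Federbush1986PhaseCellI, (0.12) p. 321] -/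
theorem latticeAction_eq_tsum_plaqTerm (r : ℕ) (a : Edge r → ℝ) :
    latticeAction r a = ∑' p : Plaq r, plaqTerm r a p := rfl

/-- **§4, closing sentence**, junk-free typing (v1.1): for a mode of the paper, every level-`s` plaquette sum `S^s_0` is a
convergent series AND `S^s_0 → ½∫F²` as `s → ∞`. «As a final note we point out it is straightforward to show the lattice
actions S^r_0 approach the continuum action as r → ∞.» [cite: Federbush1986PhaseCellI, §4 p. 329] -/
def LatticeActionsConvergeSummable (c : ℝ) : Prop :=
  ∀ (r : ℕ) (A : E4 → Fin 4 → ℝ), D.IsMode c r A →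
    (∀ s, Summable (plaqTerm s (D.bond s A))) ∧
      Tendsto (fun s => ENNReal.ofReal (latticeAction s (D.bond s A))) atTop (𝓝 (contAction A))

/-- The junk-free v1.1 predicate implies the v1 predicate `LatticeActionsConverge`. [cite: Federbush1986PhaseCellI, §4 p. 329] -/
theorem LatticeActionsConvergeSummable.latticeActionsConverge {c : ℝ} (h : D.LatticeActionsConvergeSummable c) :
    D.LatticeActionsConverge c :=
  fun r A hm => (h r A hm).2

/-- Projection: under the v1.1 predicate every level's plaquette sum of a mode is summable (so `latticeAction` is not
a junk value there). [cite: Federbush1986PhaseCellI, §4 p. 329] -/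
theorem LatticeActionsConvergeSummable.summable {c : ℝ} (h : D.LatticeActionsConvergeSummable c) {r : ℕ}
    {A : E4 → Fin 4 → ℝ} (hm : D.IsMode c r A) (s : ℕ) : Summable (plaqTerm s (D.bond s A)) :=
  (h r A hm).1 s

end AbelianAveraging

/-! ### v1.2 (docstring-only ERRATUM; fold owner r17 gen 4, 2026-08-21)
No declaration is added, removed or changed.  The docstrings of `ModeEstimates` and of `Estimate01 … Estimate07` now record
that the printed STRICT inequalities of §0, typed verbatim in v1, are vacuously false at degenerate data
(`AbelianAveraging.not_modeEstimates`, `not_estimate01_zero`, `not_estimate05_self`, `not_estimate07_self` — seat p04 gen 6,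
`AbelianEstimatesLe.lean`, p252610), and name the statements of record `ModeEstimatesLe` / `Estimate01Le … Estimate07Le`
(SKELETON row F1.Eq3.1 `refuted-as-typed p252610`; §0 rows F1.Eq0.2 … F1.Eq0.10-0.11 carry the `≤` readings).  The §4
«easy implications» between the Estimates are proved for the `≤` readings in `AbelianEstimatesSect4.lean` (p04 gen 6). -/

end

end Literature.MathematicalPhysics.QuantumFieldTheory.Federbush1986
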